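import Summits.CriticalPhenomena.PercolationContinuityZ3.Theorems.PercNearOneGluingNoHeavyLowerTailSahiAllButC

/-!
# `NoHeavyLowerTail` (crux stmt-CriticalPhenomena-4575), Sahi / Kahn positivity: row (a) of the level-`c` threshold certificate from a
# PÓLYA MULTIPLIER — `Π·((Π + D_c)·e_c − Θ_c·D_c) ∈ ℕ[r]` suffices

Support file (cell `prim-l12`, seat P3, gen 21; `--supports stmt-CriticalPhenomena-4575`).  No `sorry`, standard axioms.  Memo
`run/shared/lean/prim/prim-l12/FROM-prim-l12-p3-g21-LEVEL-C-BRIDGE-AND-TH25.md` §8.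

Row (a) of `…SahiAllButC.rhoCert_allBut` is the VALUE inequality `Θ_c(r)·D_c(r) ≤ (Π(r) + D_c(r))·e_c(r)` at the odds vector `r ≥ 0` of the block
(probabilistically `P(N ≤ c−1)·P(N ≥ c+1) ≤ P(N = c)` for the number `N` of closed coordinates).  For `c = 2` the polynomial
`F = (Π + D_c)·e_c − Θ_c·D_c` itself has nonnegative coefficients for every `k` (`…SahiAllButTwoRowA`); for `c = 3` it does NOT from `k = 6` on
(coefficient `−2` at every squarefree degree-6 monomial), but the memo's exact type-level scan finds `Π·F ∈ ℕ[r]` for `c = 3, 4` on every profile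
type tested (the multiplier `Π = ∏(1 + r_i)` is a Pólya certificate).  THIS FILE records the (trivial) passage from such a certificate to row (a):
since `Π(r) = ∏(1 + r_i) > 0`, `Π·F ∈ ℕ[r] ⇒ F(r) ≥ 0` (`aRowC_of_coeff_PiP_mul_nonneg`), and hence (`sahiE_three_nonneg_of_allBut_of_polya`) Kahn's
Conjecture 5 / Sahi's `C₃` for the level-`c` threshold slot on `k` coordinates follows from the two COEFFICIENTWISE statements
`Π·F ∈ ℕ[r]` and `Ñ_c ≥ 0` at the odds.  Nothing is asserted about the crux; no instance of the certificate is proved here.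
-/

noncomputable section

open scoped Classical

namespace Summit.CriticalPhenomena.PercolationContinuityZ3.Theorems

namespace SahiAllButC

open Finset MvPolynomial
open SahiHittingSlot SahiTransportCert SahiAllButOne SahiAllButTwo SahiCTCForms SahiCTCGenFun
open Literature.Combinatorics.Sahi2008
open Literature.Probability.Percolation (DeterminedBy)
open Literature.Probability.Percolation.DecisionTree (ind)

variable {k : ℕ}

/-- **Row (a) from a Pólya certificate.**  If `Π·((Π + D_c)·e_c − Θ_c·D_c)` has nonnegative coefficients on `k` variables, then row (a) holds at
the odds vector of every interior parameter vector on `k` coordinates. [this work] -/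
theorem aRowC_of_coeff_PiP_mul_nonneg {c : ℕ}
    (h : ∀ n, 0 ≤ (PiP * ((PiP + DdC c) * ee c - ThC c * DdC c) : MvPolynomial (Fin k) ℤ).coeff n)
    {q : Fin k → unitInterval} (hq : ∀ i, 0 < (q i : ℝ) ∧ (q i : ℝ) < 1) :
    ev q (ThC c) * ev q (DdC c) ≤ (ev q PiP + ev q (DdC c)) * ev q (ee c : MvPolynomial (Fin k) ℤ) := by
  have hW := W_pos hq
  have hPi := W_mul_ev_PiP hq
  have hPpos : 0 < ev q (PiP : MvPolynomial (Fin k) ℤ) := pos_of_mul_pos_right (by rw [hPi]; exact one_pos) hW.le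
  have h0 := eval_le_of_coeff_le (P := (0 : MvPolynomial (Fin k) ℤ)) (Q := PiP * ((PiP + DdC c) * ee c - ThC c * DdC c))
    (fun m => by rw [coeff_zero]; exact h m) (r q) (r_nonneg hq)
  rw [eval₂_zero, eval₂_mul, eval₂_sub, eval₂_mul, eval₂_mul, eval₂_add] at h0
  unfold ev at hPpos ⊢
  have hF := nonneg_of_mul_nonneg_right h0 hPpos
  linarith

/-- **KAHN'S CONJECTURE 5 / SAHI'S `C₃` FOR THE LEVEL-`c` THRESHOLD FIRST SLOT FROM TWO COEFFICIENTWISE CERTIFICATES**: the Pólya certificate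
`Π·((Π + D_c)·e_c − Θ_c·D_c) ∈ ℕ[r]` for row (a) and `Ñ_c ≥ 0` at the odds for row (TC). [this work] -/
theorem sahiE_three_nonneg_of_allBut_of_polya {ι : Type} [Fintype ι] (p : ι → unitInterval) (e : Fin k ↪ ι) {c : ℕ} (hck : c ≤ k)
    (hp : ∀ i, 0 < (p (e i) : ℝ) ∧ (p (e i) : ℝ) < 1)
    (hPolya : ∀ n, 0 ≤ (PiP * ((PiP + DdC c) * ee c - ThC c * DdC c) : MvPolynomial (Fin k) ℤ).coeff n)
    (hN : ∀ 𝒳 𝒵 : Set (Set (Fin k)), IsUpperSet 𝒳 → IsUpperSet 𝒵 → 𝒳.Nonempty → 𝒵.Nonempty → 0 ≤ ev (pk e p) (Ngen c (cx 𝒳) (cx 𝒵)))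
    {H : Set (Set ι)} (hH : DeterminedBy H (Set.range e)) (hpat : pat e H = allBut c k) {U V : Set (Set ι)} (hU : IsUpperSet U) (hV : IsUpperSet V) :
    0 ≤ sahiE (bernoulliWeight p) 3 ![ind H, ind U, ind V] := by
  have hq : ∀ i, 0 < (pk e p i : ℝ) ∧ (pk e p i : ℝ) < 1 := hp
  exact sahiE_three_nonneg_of_allBut p e hck hp (aRowC_of_coeff_PiP_mul_nonneg hPolya hq) hN hH hpat hU hV

end SahiAllButC

end Summit.CriticalPhenomena.PercolationContinuityZ3.Theorems
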